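import Mathlib
import Literature.NumberTheory.Transcendental.KZCalculusProofs
import Literature.NumberTheory.Transcendental.KZLogCalculusProofs
import Literature.NumberTheory.Transcendental.KZProductIdeal
import Literature.NumberTheory.Transcendental.KZRulesAssociator
import Summits.KontsevichZagierPeriods.KontsevichZagierPeriods.Theorems.HyperbolicBlochOffTetraSectorKernelRungZeroLogRelations
import Summits.KontsevichZagierPeriods.KontsevichZagierPeriods.Theorems.HyperbolicBlochOffTetraSectorKernelStubHermiteLindemannRing

/-!
# `OffTetraSectorKernel`, line `odd-hyperbolic-ladder`: the logarithmic part of Rogers'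
# normalisation (`stub_rogersLogIdentity`)

Stub `stub_rogersLogIdentity` of the crux `OffTetraSectorKernel`
(stmt-KontsevichZagierPeriods-10557, route HyperbolicBloch). Abel's five-term equation for the real
dilogarithm carries the logarithmic term `log((1−xy)/(1−x)) · log((1−xy)/(1−y))`; Rogers'
normalisation `L(a) = Li₂(a) + ½ log a log(1−a)` absorbs it. The absorption is a purely
LOGARITHMIC identity, and we prove it inside the Kontsevich–Zagier calculus, as a computation in
the formal period ring `P = FormalRep ⧸ relations` (`KZ.FormalPeriodRing`, a commutative ring;
`KZ.toFormalPeriod_eq_zero_iff`):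

* the log rectangle `N(a,b) = [(1,a)×(1,b), du dw/(uw)]` has the domain and the integrand of the
  Fubini product `Λ(a) × Λ(b)` of two logarithm carriers `Λ(a) = [(1,a), dt/t]`, so
  `⟦N(a,b)⟧ = ⟦Λ(a)⟧ · ⟦Λ(b)⟧` (`KZ.toFormalPeriod_of_mul_of`, congruence rule (1b));
* every multiplicative relation `c = a · b` (`a, b ≥ 1` real algebraic) is the ADDITIVE relation
  `⟦Λ(c)⟧ = ⟦Λ(a)⟧ + ⟦Λ(b)⟧` in `P` — a rung-`0` value relator of the hyperbolic scissors ladder,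
  hence a relation (`interval_log_relation_mem_relations`, no transcendence input);
* with `A = ⟦Λ(1/x)⟧`, `B = ⟦Λ(1/y)⟧`, `E = ⟦Λ(1/(1−xy))⟧`, `P = ⟦Λ((1−xy)/(1−x))⟧`,
  `Q = ⟦Λ((1−xy)/(1−y))⟧` one gets `⟦Λ(1/(1−x))⟧ = P + E`, `⟦Λ(1/(1−y))⟧ = Q + E`,
  `⟦Λ(1/(xy))⟧ = A + B`, `⟦Λ(1/X)⟧ = A + Q`, `⟦Λ(1/Y)⟧ = B + P` (`X = x(1−y)/(1−xy)`,
  `Y = y(1−x)/(1−xy)`, `1 − X = (1−x)/(1−xy)`, `1 − Y = (1−y)/(1−xy)`), and the image of the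
  six-rectangle combination is `A(P+E) + B(Q+E) − (A+B)E − (A+Q)P − (B+P)Q + 2PQ = 0` (`ring`).

References: L. J. Rogers, Proc. London Math. Soc. (2) 4 (1907), 169–189; M. Kontsevich, D. Zagier,
*Periods* (2001), §1.2, §4.1; A. B. Goncharov, *Volumes of hyperbolic manifolds and mixed Tate
motives* (1999), §1.7. No definitions are introduced.
-/

noncomputable section

open Set MeasureTheory
open Literature.NumberTheory.Transcendental Literature.ModelTheory.ExponentialFields

namespace Summit.KontsevichZagierPeriods.HyperbolicBloch.OffTetraSectorKernel

/-! ### Log rectangles are Fubini products of logarithm carriers -/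

/-- **`⟦N(a,b)⟧ = ⟦Λ(a)⟧ · ⟦Λ(b)⟧`**: the log rectangle `[(1,a)×(1,b), 1/(uw)]` has the domain
of the Fubini product `Λ(a) × Λ(b)` of the logarithm carriers and an integrand agreeing with
`(1/u)·(1/w)` on it, so the two differ by a relation (rule (1b)), and
`⟦Λ(a) × Λ(b)⟧ = ⟦Λ(a)⟧ · ⟦Λ(b)⟧` in the formal period ring. [cite: KontsevichZagier2001, §4.1] -/
theorem rogersLog_rect_class {a b : ℝ} (N : KZ.IntegralRep 2) (Λa Λb : KZ.IntegralRep 1)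
    (hNd : N.domain = {w | 1 < w 0 ∧ w 0 < a ∧ 1 < w 1 ∧ w 1 < b})
    (hNi : EqOn N.integrand (fun w => 1 / (w 0 * w 1)) N.domain)
    (hΛad : Λa.domain = {t | 1 < t 0 ∧ t 0 < a})
    (hΛai : EqOn Λa.integrand (fun t => 1 / t 0) Λa.domain)
    (hΛbd : Λb.domain = {t | 1 < t 0 ∧ t 0 < b})
    (hΛbi : EqOn Λb.integrand (fun t => 1 / t 0) Λb.domain) :
    KZ.toFormalPeriod (KZ.of N) = KZ.toFormalPeriod (KZ.of Λa) * KZ.toFormalPeriod (KZ.of Λb) := by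
  -- adapted from `toFormalPeriod_cauchyRep₂` (…/Theorems/CobordismMoveCP2Volume.lean)
  have e0 : (Fin.castAdd 1 (0 : Fin 1) : Fin 2) = 0 := rfl
  have e1 : (Fin.natAdd 1 (0 : Fin 1) : Fin 2) = 1 := rfl
  have h1 : KZ.Equivalent N (Λa.prod Λb) := by
    refine KZ.of_sub_of_mem_relations_of_eqOn ?_ fun z hz => ?_
    · ext z
      simp only [KZ.IntegralRep.prod_domain, KZ.IntegralRep.prodDomain, hΛad, hΛbd, hNd,
        mem_setOf_eq, e0, e1, and_assoc]
    · have hz' := hz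
      rw [hNd] at hz'
      obtain ⟨h0, h0a, h1', h1b⟩ := hz'
      have hza : (fun i => z (Fin.castAdd 1 i)) ∈ Λa.domain := by
        rw [hΛad]
        exact ⟨h0, h0a⟩
      have hzb : (fun j => z (Fin.natAdd 1 j)) ∈ Λb.domain := by
        rw [hΛbd]
        exact ⟨h1', h1b⟩
      rw [hNi hz, KZ.IntegralRep.prod_integrand_eq, KZ.IntegralRep.prodFun_apply, hΛai hza,
        hΛbi hzb]
      simp only [e0, e1]
      rw [one_div_mul_one_div]
  rw [h1.toFormalPeriod_eq, KZ.toFormalPeriod_of_mul_of]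

/-! ### Multiplicative relations among the arguments are additive relations among the carriers -/

/-- **`⟦Λ(ab)⟧ = ⟦Λ(a)⟧ + ⟦Λ(b)⟧`** for real algebraic `a, b ≥ 1`: `log(ab) − log a − log b = 0`
is a rung-`0` value relator among hyperbolic lengths of `ℚ̄`-intervals, hence a Kontsevich–Zagier
relation (`interval_log_relation_mem_relations`). [cite: KontsevichZagier2001, §1.2] -/
theorem rogersLog_logClass_mul {a b c : ℝ} (Λa Λb Λc : KZ.IntegralRep 1) (ha : 1 ≤ a) (hb : 1 ≤ b)
    (haa : IsAlgebraic ℚ a) (hba : IsAlgebraic ℚ b) (hc : c = a * b)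
    (hΛad : Λa.domain = {t | 1 < t 0 ∧ t 0 < a})
    (hΛai : EqOn Λa.integrand (fun t => 1 / t 0) Λa.domain)
    (hΛbd : Λb.domain = {t | 1 < t 0 ∧ t 0 < b})
    (hΛbi : EqOn Λb.integrand (fun t => 1 / t 0) Λb.domain)
    (hΛcd : Λc.domain = {t | 1 < t 0 ∧ t 0 < c})
    (hΛci : EqOn Λc.integrand (fun t => 1 / t 0) Λc.domain) :
    KZ.toFormalPeriod (KZ.of Λc) = KZ.toFormalPeriod (KZ.of Λa) + KZ.toFormalPeriod (KZ.of Λb) := by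
  -- adapted from `hermiteLindemann_mem_logPow` (…StubHermiteLindemannRing.lean)
  subst hc
  have ha0 : 0 < a := one_pos.trans_le ha
  have hb0 : 0 < b := one_pos.trans_le hb
  have hrel := interval_log_relation_mem_relations 3 ![1, 1, 1] ![a * b, a, b] ![1, -1, -1]
    ![Λc, Λa, Λb]
    (fun i => by fin_cases i <;> simp)
    (fun i => by fin_cases i <;> simp [ha, hb, one_le_mul_of_one_le_of_one_le ha hb])
    (fun i => by fin_cases i <;> exact isAlgebraic_one)
    (fun i => by fin_cases i <;> simp [haa, hba, haa.mul hba])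
    (fun i => by
      fin_cases i
      · exact ⟨hΛcd, hΛci⟩
      · exact ⟨hΛad, hΛai⟩
      · exact ⟨hΛbd, hΛbi⟩)
    (by
      simp only [Fin.sum_univ_three, Matrix.cons_val_zero, Matrix.cons_val_one, Matrix.head_cons,
        Matrix.cons_val_two, Matrix.tail_cons, div_one, Int.cast_one, Int.cast_neg,
        Real.log_mul ha0.ne' hb0.ne']
      ring)
  have e : ∑ i : Fin 3, (![1, -1, -1] i : ℤ) • KZ.of (![Λc, Λa, Λb] i) =
      KZ.of Λc - (KZ.of Λa + KZ.of Λb) := by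
    simp only [Fin.sum_univ_three, Matrix.cons_val_zero, Matrix.cons_val_one, Matrix.head_cons,
      Matrix.cons_val_two, Matrix.tail_cons, one_smul, neg_smul]
    abel
  rw [e] at hrel
  rw [← map_add KZ.toFormalPeriod]
  exact KZ.toFormalPeriod_eq_iff.mpr hrel

/-- **`⟦Λ(a)⟧ + ⟦Λ(b)⟧ = ⟦Λ(c)⟧ + ⟦Λ(d)⟧` when `ab = cd`** (`a, b, c, d ≥ 1` real algebraic):
both sides equal `⟦Λ(ab)⟧`. [cite: KontsevichZagier2001, §1.2] -/
theorem rogersLog_logClass_mul_eq_mul {a b c d : ℝ} (Λa Λb Λc Λd : KZ.IntegralRep 1)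
    (ha : 1 ≤ a) (hb : 1 ≤ b) (hc : 1 ≤ c) (hd : 1 ≤ d)
    (haa : IsAlgebraic ℚ a) (hba : IsAlgebraic ℚ b) (hca : IsAlgebraic ℚ c) (hda : IsAlgebraic ℚ d)
    (h : a * b = c * d)
    (hΛad : Λa.domain = {t | 1 < t 0 ∧ t 0 < a})
    (hΛai : EqOn Λa.integrand (fun t => 1 / t 0) Λa.domain)
    (hΛbd : Λb.domain = {t | 1 < t 0 ∧ t 0 < b})
    (hΛbi : EqOn Λb.integrand (fun t => 1 / t 0) Λb.domain)
    (hΛcd : Λc.domain = {t | 1 < t 0 ∧ t 0 < c})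
    (hΛci : EqOn Λc.integrand (fun t => 1 / t 0) Λc.domain)
    (hΛdd : Λd.domain = {t | 1 < t 0 ∧ t 0 < d})
    (hΛdi : EqOn Λd.integrand (fun t => 1 / t 0) Λd.domain) :
    KZ.toFormalPeriod (KZ.of Λa) + KZ.toFormalPeriod (KZ.of Λb) =
      KZ.toFormalPeriod (KZ.of Λc) + KZ.toFormalPeriod (KZ.of Λd) := by
  obtain ⟨Λm, hΛmd, hΛmi⟩ := hermiteLindemann_exists_log (haa.mul hba)
  rw [← rogersLog_logClass_mul Λa Λb Λm ha hb haa hba rfl hΛad hΛai hΛbd hΛbi hΛmd hΛmi,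
    ← rogersLog_logClass_mul Λc Λd Λm hc hd hca hda h hΛcd hΛci hΛdd hΛdi hΛmd hΛmi]

/-! ### The identity -/

/-- **STUB `stub_rogersLogIdentity` (the logarithmic part of Rogers' normalisation, in the formal
period ring).** With `N(a,b) = [(1,a)×(1,b), 1/(uw)]` (`⟦N(a,b)⟧ = ⟦Λ(a)⟧·⟦Λ(b)⟧`,
`Λ(a) = [(1,a), dt/t]`, Fubini product) and `X = x(1−y)/(1−xy)`, `Y = y(1−x)/(1−xy)`:
`N(1/x,1/(1−x)) + N(1/y,1/(1−y)) − N(1/(xy),1/(1−xy)) − N(1/X,1/(1−X)) − N(1/Y,1/(1−Y))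
  + 2·N((1−xy)/(1−x),(1−xy)/(1−y))` is a relation: writing `A = ⟦Λ(1/x)⟧`, `B = ⟦Λ(1/y)⟧`,
`E = ⟦Λ(1/(1−xy))⟧`, `P = ⟦Λ((1−xy)/(1−x))⟧`, `Q = ⟦Λ((1−xy)/(1−y))⟧`, the multiplicative relations
among the arguments (rung `0`, `interval_log_relation_mem_relations`) give `⟦Λ(1/(1−x))⟧ = P + E`,
`⟦Λ(1/(1−y))⟧ = Q + E`, `⟦Λ(1/(xy))⟧ = A + B`, `⟦Λ(1/X)⟧ = A + Q`, `⟦Λ(1/(1−X))⟧ = P`,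
`⟦Λ(1/Y)⟧ = B + P`, `⟦Λ(1/(1−Y))⟧ = Q`, and
`A(P+E) + B(Q+E) − (A+B)E − (A+Q)P − (B+P)Q + 2PQ = 0` identically (`ring`).
[cite: KontsevichZagier2001, §1.2] -/
theorem stub_rogersLogIdentity :
    ∀ (x y : ℝ), IsAlgebraic ℚ x → IsAlgebraic ℚ y → 0 < x → x < 1 → 0 < y → y < 1 →
    ∀ (N₁ N₂ N₃ N₄ N₅ M : KZ.IntegralRep 2),
      N₁.domain = {w | 1 < w 0 ∧ w 0 < 1 / x ∧ 1 < w 1 ∧ w 1 < 1 / (1 - x)} →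
      Set.EqOn N₁.integrand (fun w => 1 / (w 0 * w 1)) N₁.domain →
      N₂.domain = {w | 1 < w 0 ∧ w 0 < 1 / y ∧ 1 < w 1 ∧ w 1 < 1 / (1 - y)} →
      Set.EqOn N₂.integrand (fun w => 1 / (w 0 * w 1)) N₂.domain →
      N₃.domain = {w | 1 < w 0 ∧ w 0 < 1 / (x * y) ∧ 1 < w 1 ∧ w 1 < 1 / (1 - x * y)} →
      Set.EqOn N₃.integrand (fun w => 1 / (w 0 * w 1)) N₃.domain →
      N₄.domain = {w | 1 < w 0 ∧ w 0 < 1 / (x * (1 - y) / (1 - x * y)) ∧ 1 < w 1 ∧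
        w 1 < 1 / (1 - x * (1 - y) / (1 - x * y))} →
      Set.EqOn N₄.integrand (fun w => 1 / (w 0 * w 1)) N₄.domain →
      N₅.domain = {w | 1 < w 0 ∧ w 0 < 1 / (y * (1 - x) / (1 - x * y)) ∧ 1 < w 1 ∧
        w 1 < 1 / (1 - y * (1 - x) / (1 - x * y))} →
      Set.EqOn N₅.integrand (fun w => 1 / (w 0 * w 1)) N₅.domain →
      M.domain = {w | 1 < w 0 ∧ w 0 < (1 - x * y) / (1 - x) ∧ 1 < w 1 ∧ w 1 < (1 - x * y) / (1 - y)} →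
      Set.EqOn M.integrand (fun w => 1 / (w 0 * w 1)) M.domain →
      KZ.of N₁ + KZ.of N₂ - KZ.of N₃ - KZ.of N₄ - KZ.of N₅ + 2 • KZ.of M ∈ KZ.relations := by
  intro x y hx hy hx0 hx1 hy0 hy1 N₁ N₂ N₃ N₄ N₅ M hN₁d hN₁i hN₂d hN₂i hN₃d hN₃i hN₄d hN₄i hN₅d hN₅i
    hMd hMi
  -- signs
  have h1x : 0 < 1 - x := by linarith
  have h1y : 0 < 1 - y := by linarith
  have hxy0 : 0 < x * y := mul_pos hx0 hy0
  have hxy1 : x * y < 1 := by nlinarith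
  have h1xy : 0 < 1 - x * y := by linarith
  have hx0' : x ≠ 0 := hx0.ne'
  have hy0' : y ≠ 0 := hy0.ne'
  have h1x' : 1 - x ≠ 0 := h1x.ne'
  have h1y' : 1 - y ≠ 0 := h1y.ne'
  have h1xy' : 1 - x * y ≠ 0 := h1xy.ne'
  -- `1 − X = (1−x)/(1−xy)`, `1 − Y = (1−y)/(1−xy)`: normalise the arguments of `N₄`, `N₅`
  have hX : 1 - x * (1 - y) / (1 - x * y) = (1 - x) / (1 - x * y) := by
    rw [eq_div_iff h1xy', sub_mul, div_mul_cancel₀ _ h1xy']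
    ring
  have hY : 1 - y * (1 - x) / (1 - x * y) = (1 - y) / (1 - x * y) := by
    rw [eq_div_iff h1xy', sub_mul, div_mul_cancel₀ _ h1xy']
    ring
  rw [hX] at hN₄d
  rw [hY] at hN₅d
  simp only [one_div_div] at hN₄d hN₅d
  -- the ten arguments: algebraic, at least `1`
  have hdiv : ∀ {a b : ℝ}, IsAlgebraic ℚ a → IsAlgebraic ℚ b → IsAlgebraic ℚ (a / b) :=
    fun ha hb => by rw [div_eq_mul_inv]; exact ha.mul hb.inv
  have aA : IsAlgebraic ℚ (1 / x) := hdiv isAlgebraic_one hx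
  have aB : IsAlgebraic ℚ (1 / y) := hdiv isAlgebraic_one hy
  have aC : IsAlgebraic ℚ (1 / (1 - x)) :=
    hdiv isAlgebraic_one (isAlgebraic_one.sub hx)
  have aD : IsAlgebraic ℚ (1 / (1 - y)) :=
    hdiv isAlgebraic_one (isAlgebraic_one.sub hy)
  have aE : IsAlgebraic ℚ (1 / (1 - x * y)) :=
    hdiv isAlgebraic_one (isAlgebraic_one.sub (hx.mul hy))
  have aF : IsAlgebraic ℚ (1 / (x * y)) := hdiv isAlgebraic_one (hx.mul hy)
  have aG : IsAlgebraic ℚ ((1 - x * y) / (x * (1 - y))) :=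
    hdiv (isAlgebraic_one.sub (hx.mul hy)) (hx.mul (isAlgebraic_one.sub hy))
  have aH : IsAlgebraic ℚ ((1 - x * y) / (y * (1 - x))) :=
    hdiv (isAlgebraic_one.sub (hx.mul hy)) (hy.mul (isAlgebraic_one.sub hx))
  have aP : IsAlgebraic ℚ ((1 - x * y) / (1 - x)) :=
    hdiv (isAlgebraic_one.sub (hx.mul hy)) (isAlgebraic_one.sub hx)
  have aQ : IsAlgebraic ℚ ((1 - x * y) / (1 - y)) :=
    hdiv (isAlgebraic_one.sub (hx.mul hy)) (isAlgebraic_one.sub hy)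
  have lA : 1 ≤ 1 / x := (one_le_div hx0).2 hx1.le
  have lB : 1 ≤ 1 / y := (one_le_div hy0).2 hy1.le
  have lC : 1 ≤ 1 / (1 - x) := (one_le_div h1x).2 (by linarith)
  have lD : 1 ≤ 1 / (1 - y) := (one_le_div h1y).2 (by linarith)
  have lE : 1 ≤ 1 / (1 - x * y) := (one_le_div h1xy).2 (by linarith)
  have lF : 1 ≤ 1 / (x * y) := (one_le_div hxy0).2 hxy1.le
  have lG : 1 ≤ (1 - x * y) / (x * (1 - y)) := (one_le_div (mul_pos hx0 h1y)).2 (by nlinarith)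
  have lH : 1 ≤ (1 - x * y) / (y * (1 - x)) := (one_le_div (mul_pos hy0 h1x)).2 (by nlinarith)
  have lP : 1 ≤ (1 - x * y) / (1 - x) := (one_le_div h1x).2 (by nlinarith)
  have lQ : 1 ≤ (1 - x * y) / (1 - y) := (one_le_div h1y).2 (by nlinarith)
  -- the ten logarithm carriers
  obtain ⟨ΛA, hΛAd, hΛAi⟩ := hermiteLindemann_exists_log aA
  obtain ⟨ΛB, hΛBd, hΛBi⟩ := hermiteLindemann_exists_log aB
  obtain ⟨ΛC, hΛCd, hΛCi⟩ := hermiteLindemann_exists_log aC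
  obtain ⟨ΛD, hΛDd, hΛDi⟩ := hermiteLindemann_exists_log aD
  obtain ⟨ΛE, hΛEd, hΛEi⟩ := hermiteLindemann_exists_log aE
  obtain ⟨ΛF, hΛFd, hΛFi⟩ := hermiteLindemann_exists_log aF
  obtain ⟨ΛG, hΛGd, hΛGi⟩ := hermiteLindemann_exists_log aG
  obtain ⟨ΛH, hΛHd, hΛHi⟩ := hermiteLindemann_exists_log aH
  obtain ⟨ΛP, hΛPd, hΛPi⟩ := hermiteLindemann_exists_log aP
  obtain ⟨ΛQ, hΛQd, hΛQi⟩ := hermiteLindemann_exists_log aQ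
  -- the six rectangles as products
  have e₁ := rogersLog_rect_class N₁ ΛA ΛC hN₁d hN₁i hΛAd hΛAi hΛCd hΛCi
  have e₂ := rogersLog_rect_class N₂ ΛB ΛD hN₂d hN₂i hΛBd hΛBi hΛDd hΛDi
  have e₃ := rogersLog_rect_class N₃ ΛF ΛE hN₃d hN₃i hΛFd hΛFi hΛEd hΛEi
  have e₄ := rogersLog_rect_class N₄ ΛG ΛP hN₄d hN₄i hΛGd hΛGi hΛPd hΛPi
  have e₅ := rogersLog_rect_class N₅ ΛH ΛQ hN₅d hN₅i hΛHd hΛHi hΛQd hΛQi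
  have e₆ := rogersLog_rect_class M ΛP ΛQ hMd hMi hΛPd hΛPi hΛQd hΛQi
  -- the five additive relations among the carriers
  have rF : KZ.toFormalPeriod (KZ.of ΛF) =
      KZ.toFormalPeriod (KZ.of ΛA) + KZ.toFormalPeriod (KZ.of ΛB) :=
    rogersLog_logClass_mul ΛA ΛB ΛF lA lB aA aB (by rw [one_div_mul_one_div])
      hΛAd hΛAi hΛBd hΛBi hΛFd hΛFi
  have rC : KZ.toFormalPeriod (KZ.of ΛC) =
      KZ.toFormalPeriod (KZ.of ΛP) + KZ.toFormalPeriod (KZ.of ΛE) :=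
    rogersLog_logClass_mul ΛP ΛE ΛC lP lE aP aE
      (by rw [div_mul_div_comm, div_eq_div_iff h1x' (mul_ne_zero h1x' h1xy')]; ring)
      hΛPd hΛPi hΛEd hΛEi hΛCd hΛCi
  have rD : KZ.toFormalPeriod (KZ.of ΛD) =
      KZ.toFormalPeriod (KZ.of ΛQ) + KZ.toFormalPeriod (KZ.of ΛE) :=
    rogersLog_logClass_mul ΛQ ΛE ΛD lQ lE aQ aE
      (by rw [div_mul_div_comm, div_eq_div_iff h1y' (mul_ne_zero h1y' h1xy')]; ring)
      hΛQd hΛQi hΛEd hΛEi hΛDd hΛDi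
  have rG : KZ.toFormalPeriod (KZ.of ΛG) + KZ.toFormalPeriod (KZ.of ΛE) =
      KZ.toFormalPeriod (KZ.of ΛA) + KZ.toFormalPeriod (KZ.of ΛD) :=
    rogersLog_logClass_mul_eq_mul ΛG ΛE ΛA ΛD lG lE lA lD aG aE aA aD
      (by
        rw [div_mul_div_comm, div_mul_div_comm,
          div_eq_div_iff (mul_ne_zero (mul_ne_zero hx0' h1y') h1xy') (mul_ne_zero hx0' h1y')]
        ring)
      hΛGd hΛGi hΛEd hΛEi hΛAd hΛAi hΛDd hΛDi
  have rH : KZ.toFormalPeriod (KZ.of ΛH) + KZ.toFormalPeriod (KZ.of ΛE) =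
      KZ.toFormalPeriod (KZ.of ΛB) + KZ.toFormalPeriod (KZ.of ΛC) :=
    rogersLog_logClass_mul_eq_mul ΛH ΛE ΛB ΛC lH lE lB lC aH aE aB aC
      (by
        rw [div_mul_div_comm, div_mul_div_comm,
          div_eq_div_iff (mul_ne_zero (mul_ne_zero hy0' h1x') h1xy') (mul_ne_zero hy0' h1x')]
        ring)
      hΛHd hΛHi hΛEd hΛEi hΛBd hΛBi hΛCd hΛCi
  -- compute in the formal period ring
  rw [← KZ.toFormalPeriod_eq_zero_iff, map_add, map_sub, map_sub, map_sub, map_add, map_nsmul,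
    e₁, e₂, e₃, e₄, e₅, e₆]
  linear_combination (-KZ.toFormalPeriod (KZ.of ΛE)) * rF
    + (-KZ.toFormalPeriod (KZ.of ΛP)) * rG + (-KZ.toFormalPeriod (KZ.of ΛQ)) * rH
    + (KZ.toFormalPeriod (KZ.of ΛA) - KZ.toFormalPeriod (KZ.of ΛQ)) * rC
    + (KZ.toFormalPeriod (KZ.of ΛB) - KZ.toFormalPeriod (KZ.of ΛP)) * rD

end Summit.KontsevichZagierPeriods.HyperbolicBloch.OffTetraSectorKernel

end
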